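import Mathlib
import HarnessLib
import HarnessLib.Audit
import Summits.QuantumAdvantage.Statement
import Summits.QuantumAdvantage.AdviceFreeQNC0.AdviceFreeQNC0
import Summits.QuantumAdvantage.AdviceFreeQNC0.RingHardOdd
import Summits.QuantumAdvantage.AdviceFreeQNC0.AdviceFreeQNC0Three
import Summits.QuantumAdvantage.AdviceFreeQNC0.AffBells37PolyLoss
import Summits.QuantumAdvantage.AdviceFreeQNC0.BondTwistLocal
import Summits.QuantumAdvantage.QuantumAdvantage.Theorems.RingFrameBridge
import HarnessLib.Audit.Status.Attr

/-!
Route: ProductDial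

# Route ProductDial — RingHardOdd 3 bypassed by a many-rings target — loss dial × ring-count dial,
direct-product lift (rung F-Q1-p3)

DECOMPOSITION CELL decomp-qadv (D-0178/D-0179; doctrine D-0170/0171/0172), RESIDUAL MODE, node
ProductDial (lens decomp-qadv-lens-5-g2 «strengthen
into something more attackable / structural», NODE 2026-08-30T02:38:02Z + addendum 02:44:40Z; node
file run/shared/lean/pub/decomp-qadv/decomp-qadv-lens-5/ProductDial.lean (0 sorry, rc 0; v1 sha256
674e815d…6cd0c, v2 264ac224…c3e3, current 1a08d8a6…; binders and `closes` byte-identical across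
versions); critic: critic decomp-qadv-crit-1 g2
CLEARED 2026-08-30T02:44:11Z, CRITIC-LEDGER row 9 (N ✓✓ census-v2-driven · W layer-1 ✓ by
construction, layer-2 PolyLoss3 ✓/✓ vs 22907 and 24214,
DPLift3 NO-SHRINK as bridge · B ✓ · D ✓ layer 1 (T* carries all), layer 2 PARTIAL-but-honest · E ✓ ·
C ✓✓: first node whose census prediction
can falsify the parent T itself); census basis COSTUME-CENSUS-v2 (json sha256 28142e6c…, LAW F3:
every shift-periodic local strategy has odd-class
value exactly 1/2; v1 sha256 40a0d45d…). RUNG CURRENCY ONLY — NOTHING HERE BEARS ON THE ROOT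
`QuantumAdvantage := ∃ L, L ∈ BQP ∧ L ∉ BPP`.
SIBLING rung route of DegreeDial (not a refines-child): it BYPASSES the blocker item
stmt-QuantumAdvantage-22907 (DWalkThree, open content
`RingHardOdd 3` =: T) and DegreeDial:24213/24214 — T → T* and T → PolyLoss3 are PROVED in the node
file (`multiRingHard3_of_ringHardOdd`,
`polyLoss3_of_ringHardOdd`), the leaf F-Q1-p3 is shared, and ¬DPLift3 ⇔ PolyLoss3 ∧ ¬T* ⇒ ¬T (SAFETY
FACT: a refutation of the lift kills 22907
and 24213 too). It suffices to show X = MultiRingHard3 (T*, the reformulated target, rank 0): for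
some K and θ < 1, polylog-degree JOINT
𝔽₃-strategies for n^K disjoint n-cycles (each output may read all n^K·n input bits) win ALL rings on
at most a θ-fraction of input tuples
(plain count over all inputs — no parity class, no 2^(n−1) normalisation: both costume surfaces of T
are gone); X feeds the registered leaf
hypothesis `HLFNotFAC0Mod 3` through the support MultiRingBridge3 (pack the rings into the 2D grid;
adapt `hlfNotFAC0Mod_of_ringHard8`).
Layer 2 (the filed cruxes): X ⇐ PolyLoss3 ∧ DPLift3 — an inverse-polynomial single-ring loss at
every polylog degree, and the direct-product
lift from that loss to T*.
Lean: `∃ K : ℕ, ∃ θ : ℝ, θ < 1 ∧ ∀ c : ℕ, ∃ n₀ : ℕ, ∀ n ≥ n₀, ∀ P : Fin (n ^ K) → Fin n →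
Literature.Computability.MetaComplexity.Smolensky.CubeFn (ZMod 3) (n ^ K * n), (∀ j i, P j i ∈
Literature.Computability.MetaComplexity.Smolensky.lowDeg (ZMod 3) (n ^ K * n) ((Nat.log 2 n) ^ c)) →
((Finset.univ.filter fun X : Fin (n ^ K) → Fin n → Bool => ∀ j,
Literature.Computability.QuantumComplexity.RingHLF.Rel (X j) (fun i => decide (P j i (fun k => X
(finProdFinEquiv.symm k).1 (finProdFinEquiv.symm k).2) = 1))).card : ℝ) ≤ θ * (2 : ℝ) ^ (n ^ K * n)`

## Assembly
`closes` (glue.lean, one line): MultiRingBridge3 (DPLift3 PolyLoss3) : HLFNotFAC0Mod 3, then the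
landed bridge
`Theorems.adviceFreeQNC0Sep_of_hlfNotFAC0Mod 3` (RingFrameBridge.lean:61) and
`adviceFreeQNC0Three_iff` give the leaf AdviceFreeQNC0Three
(= AdviceFreeQNC0Sep 3, closes_target F-Q1-p3). Layer 1 alone: closes₁ (hM : MultiRingHard3) (hB :
MultiRingBridge3) (node file `closes`).
The Assembly item restates `closes` as a Prop; the deciding theorem is `closes`.

CLOSES_TARGET: closes rung F-Q1-p3 of QuantumAdvantage: Summit.QuantumAdvantage.AdviceFreeQNC0.AdviceFreeQNC0Three (D-0061; not the summit Statement) — the deciding theorem of this route concludes that registered leaf instead of the Statement decl `QuantumAdvantage` (class rung: servable and labelled, never counted as concluding the summit Statement).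

Rationale: WHY THIS LINE. Census v2 LAW F3 and the BondTwist/AffBells affine work show T's difficulty is
concentrated in the constant-θ demand on ONE ring restricted to
the odd class; the BGK/WKST separation (arXiv:1704.00690 Thm 1, arXiv:1906.08890 §1.3) never needed
one ring — the 2D-HLF instance family
contains n^K disjoint cycles, so the classical-hardness hypothesis of the registered leaf
(`HLFNotFAC0Mod 3`) is already implied by hardness
of winning MANY rings simultaneously (T*), which is implied by T (proved) but asks each ring only
for what a direct-product theorem can
amplify. Imported area: hardness amplification / direct-product theorems for restricted models
(Viola–Wigderson doi:10.4086/toc.2008.v004a007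
Cor. 1.6 for GF(2) polynomials of constant degree; Impagliazzo–Jaiswal–Kabanets–Wigderson
doi:10.1137/080734030; parallel repetition for the
BGK relation in WKST19 arXiv:1906.08890 §5) — it supplies the shape of DPLift3 and its proved
special cases in the node file (separable
strategies `dpSeparable3`, triangular/causal reading orders `dpTriangular3`, both from PolyLoss3 by
an induction over rings). What is new
relative to every listed route: the loss dial (1/n^k instead of a constant) and the ring-count dial
(n^K rings) are traded against each other,
so the single-ring statement to prove (PolyLoss3) is strictly weaker than both open single-ring
cruxes of record (22907's T and 24214's
AffineCore3 demand constant loss), its degree-1 rung is a tree theorem (AffBells37 ⇒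
`polyLossOne3`), and the residual is a LIFT statement
with a literature template rather than a hardness statement.

RANKED CRUXES. #0 MultiRingHard3 (target) — T* (the reformulated target, rank 0; assembly conclusion
of layer 2): there are K and θ < 1 such that for every c, for all large n, every joint strategy for
n^K rings of length n whose outputs are 𝔽₃-polynomials of degree ≤ (log₂ n)^c in all n^K·n input
bits wins all rings (each ring's output satisfies RingHLF.Rel) on at most θ·2^(n^K·n) input tuples.
T → T* proved (node file `multiRingHard3_of_ringHardOdd`); T* → PolyLoss3 proved
(`polyLoss3_of_multiRingHard3`). [deps: PolyLoss3, DPLift3] [difficulty: open-problem] (why it might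
fail: only if T* is false, which (given PolyLoss3) refutes T = RingHardOdd 3 and with it
DWalkThree:22907 and DegreeDial:24213 — a joint polylog-degree strategy winning all n^K rings with
probability bounded below would be a new classical simulation phenomenon for HLF.)
[arXiv:1704.00690, arXiv:1906.08890, doi:10.4086/toc.2008.v004a007]
#2 PolyLoss3 (crux) — inverse-polynomial single-ring loss at every polylog degree: some k such that
for every c, for all large n, every single-ring 𝔽₃-strategy (z_i = [P_i(x) = 1], deg P_i ≤ (log₂
n)^c) satisfies the n-cycle relation RingHLF.Rel on at most (1 − n^(−k))·2^n of ALL 2^n inputs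
(plain count). Strictly weaker than T (T ⇒ PolyLoss3, `polyLoss3_of_ringHardOdd`) and than
AffineCore3's constant-loss demand; degree-1 slice PROVED (`polyLossOne3`, from the tree's
AffBells37.affBellsPolyLoss3). [difficulty: L] (why it might fail: open above degree 1: a
degree-(log n)^c tuple might interpolate the which-path walk on all but an n^(−ω(1)) fraction of
inputs (census LAW F3 pins loss 1/2 only for shift-periodic local strategies); no loss bound for 𝔽₃
tuples vs the mod-2 path count is in print beyond affine.) [arXiv:1704.00690, arXiv:1906.08890,
doi:10.1145/28395.28404, doi:10.1016/j.jcss.2004.01.003]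
#3 DPLift3 (crux) — DECLARED-RESIDUAL (NO-SHRINK piece, critic row 9): the direct-product lift
PolyLoss3 → MultiRingHard3 — an inverse-polynomial loss per ring at every polylog degree amplifies,
over n^K disjoint rings read JOINTLY, to a constant all-rings bound. Proved special cases in the
node file: separable strategies (`dpSeparable3`) and triangular/causal reading orders
(`dpTriangular3`, induction over rings via `card_winAllSet_triangular_le`); the symmetric
cross-reading case is the open content; constant-degree sub-rung DPLiftConst3 filed as aside. [deps:
PolyLoss3] [difficulty: open-problem] (why it might fail: no direct-product theorem for
polylog-degree 𝔽_p polynomials exists: Viola–Wigderson's decays like exp(−Ω(εm/(d·4^d))), vacuous at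
d ≥ log m; rings read jointly can correlate wins (only causal orders proved); GSV18: black-box
amplification proofs need majority, absent at low degree.) [doi:10.4086/toc.2008.v004a007,
doi:10.1137/080734030, arXiv:1906.08890, eccc:TR18-061]
#9 MultiRingBridge3 (support) — LOAD-BEARING support (binder of `closes`; critic: staff/land FIRST):
T* feeds the registered leaf hypothesis — MultiRingHard3 → HLFNotFAC0Mod 3: restrict N×N 2D-HLF
circuits over accBasis 3 to instances carrying n^K disjoint square cycles of length n, turn the
FAC⁰[3] circuit tuple into ONE joint polylog-degree 𝔽₃-strategy for all rings at once by the
relational Razborov–Smolensky lemma (tree `Smolensky.exists_uniformProb_le`, error counted once for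
the whole tuple), transfer HLF solutions to ring wins ring by ring (tree
`GridCycle.rel_of_mem_hlfSolutions`), exactly as the single-ring bridge
`Theorems.hlfNotFAC0Mod_of_ringHard8` (RingFrameBridge.lean:119) with the packing of n^K cycles
replacing one 8t-cycle. [difficulty: M] (why it might fail: routine adaptation, two checks: the grid
side N ≈ n^((K+1)/2)·O(1) must carry n^K disjoint cycles with disjoint encodings, and the
probabilistic-polynomial error (1/poly(N)) must be charged once to the joint tuple, not per ring.)
[arXiv:1704.00690, arXiv:1906.08890, doi:10.1145/28395.28404]
#9 PolyLossOne3 (support) — ASIDE (file as kind aside; PROVED in the node file, theorem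
`polyLossOne3`, from the tree's `AffBells37.affBellsPolyLoss3` + the even-class count): the degree-1
slice of PolyLoss3 — affine single-ring strategies lose an inverse-polynomial fraction of all
inputs. BC5 witness rung of PolyLoss3 (outside S's known regime: T's affine slice AffineCore3 =
BondTwist3.RingAffineBellsLt3 is OPEN). [difficulty: S] [arXiv:1704.00690,
doi:10.1016/j.jcss.2004.01.003]
#9 PolyLossTwo3 (support) — ASIDE (kind aside; first OPEN rung of the loss dial, ATTACKABLE): the
degree-2 slice of PolyLoss3 — quadratic single-ring 𝔽₃-strategies lose an inverse-polynomial
fraction of all inputs (census v2 T2: the degree-2 margin over affine is transient at N ≤ 12).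
[difficulty: M] [doi:10.1016/j.jcss.2004.01.003, doi:10.4086/toc.2008.v004a007]
#9 PolyLossLog3 (support) — ASIDE (kind aside; the rung just past the degree-log line): the
degree-log₂ n slice of PolyLoss3. [difficulty: L] [doi:10.4086/toc.2019.v015a001,
doi:10.1145/28395.28404]
#9 MultiRingHardSeparable3 (support) — ASIDE (kind aside; PROVED from PolyLoss3 in the node file,
`dpSeparable3`): T* for SEPARABLE joint strategies (ring j reads only ring j) — the product case of
the direct product, by independence and (1 − n^(−k))^(n^(k+1)) ≤ e^(−1)-type decay. [difficulty: S]
[doi:10.4086/toc.2008.v004a007]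
#9 MultiRingHardTriangular3 (support) — ASIDE (kind aside; PROVED from PolyLoss3 in the node file,
`dpTriangular3` via `card_winAllSet_triangular_le`): T* for TRIANGULAR joint strategies (ring j's
outputs read only rings j' ≥ j) — the causal case of the direct product, an induction over rings
conditioning on the tail. [difficulty: S] [doi:10.4086/toc.2008.v004a007, doi:10.1137/080734030]
#9 MultiRingHardAffine3 (support) — ASIDE with a RANK NOTE (kind aside at birth for BC6; critic row
9 recommends it as the natural FIRST STAFFED statement of this route — tenure may promote it to a
ranked statement): T* for JOINT AFFINE strategies (every output of degree ≤ 1 in all n^K·n bits) —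
the first open rung of T* proper; its separable sub-case is PROVED unconditionally
(`multiRingHardSepAffine3`), while T's affine slice AffineCore3 (DegreeDial:24214) is open; it is
the d = 1 case of DPLiftConst3 (`multiRingHardAffine3_of_dpLiftConst3`). [difficulty: M]
[doi:10.1016/j.jcss.2004.01.003, arXiv:1906.08890]
#9 DPLiftConst3 (support) — ASIDE (kind aside; the ATTACKABLE constant-degree sub-rung of DPLift3
suggested by the critic, row 9 (ii)): for every fixed total degree d, an inverse-polynomial
single-ring loss at degree d implies T* at degree d (some K, θ < 1) — the 𝔽₃/search-relation
analogue of Viola–Wigderson's direct-product lemma for constant-degree GF(2) polynomials (Cor. 1.6),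
whose decay exp(−Ω(εm/(d·4^d))) is non-trivial exactly in this regime. [difficulty: L]
[doi:10.4086/toc.2008.v004a007]

TWO-LAYER PLAN. Layer 1: T* (MultiRingHard3, target) + MultiRingBridge3 (support, load-bearing) →
leaf. Layer 2 (filed): T* ⇐ PolyLoss3 ∧ DPLift3 (modus
ponens). Foreseen glued splits, NOT filed now: PolyLoss3 along the degree dial (PolyLossTwo3 →
PolyLossLog3 → PolyLoss3, asides, attached by
provers with --supports); DPLift3 along the structure dial (separable PROVED → triangular PROVED →
constant total degree DPLiftConst3 → joint
affine MultiRingHardAffine3 → polylog), never a third layer.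

KILL CRITERIA. Census order fixed by the critic (row 9): M2 FIRST — search for a joint low-degree
strategy on m small rings whose all-rings win probability
beats the product of single-ring optima by more than the triangular bound allows (a falsifier of
DPLift3 AND, given PolyLoss3's proved
slices, evidence against T itself: ¬DPLift3 ⇔ PolyLoss3 ∧ ¬T* ⇒ ¬T, killing 22907 and 24213 with
it); then M0 — fit k in the single-ring loss
1/n^k at degrees 1, 2, 3 for n ≤ 14 (a loss decaying faster than any polynomial at degree 2 refutes
PolyLoss3 as typed: route closes
refuted:PolyLoss3, and T dies too since T ⇒ PolyLoss3); then M1 — the K needed for θ at the proved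
separable rate. A proof of T (22907) moots
the route (T ⇒ T* proved). A refutation of MultiRingBridge3 is impossible short of an error in the
packing (it is implied by the single-ring
bridge pattern); if the packing fails for parity/size reasons the route is repaired by changing K ↦
grid side, not closed.

NOT DECOMPOSED YET. DPLift3 beyond its proved separable/triangular cases and the constant-degree
aside (no mechanism in print for the symmetric polylog-degree
case — IDEA-NEEDED leaf); PolyLoss3 above degree 2 (the degree dial's rungs are asides, not items);
the bridge's packing constant.

CHEAPEST FALSIFIER. M0 of the census plan on PolyLoss3: exhaustive/ILP optimum of the single-ring
all-inputs win count for degree ≤ 2 𝔽₃-strategies at n = 6..12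
(census v2 engines exist: j337589 tables T1/T2) — if the optimal loss at degree 2 already drops
below every 1/n^k fit (e.g. like 2^(−n)), PolyLoss3
is dead as typed and so is T; and M2 on two and three rings of length 4..6: any joint affine
strategy beating the product value kills the
affine rung of DPLift3 outright (in-Lean `decide`-sized at n = 4, m = 2).

NUMBERS. Separable rate (node file `multiHardSepAt_of_lossAt`): with loss 1/n^k per ring and n^(k+1)
rings the all-rings fraction is ≤ (1 − n^(−k))^(n^(k+1))
≤ e^(−n) ≤ e^(−1) =: θ, so K = k + 1 suffices in the separable and triangular cases. Viola–Wigderson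
XOR lemma (Thm 1.2): correlation of degree-d
GF(2) polynomials with f^(⊕m) ≤ exp(−Ω(m·ε/(d·4^d))) — at d = (log₂ n)^c this is ≥ exp(−m/n^(2(log
n)^(c−1))) i.e. no decay for m = n^K: the
literature template does NOT reach the polylog regime (BC9 ceiling). Census v2 (j337589): no affine
translation-invariant family with
odd-class value ≥ 0.70 at N ≥ 12; LAW F3 value exactly 1/2 for shift-periodic local strategies.

DEFINITION REQUESTS. None — every item is typed over existing declarations (Smolensky.CubeFn/lowDeg,
RingHLF.Rel, finProdFinEquiv, HLFNotFAC0Mod); the node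
file's bookkeeping defs (winSet, flat, JointStrategy, WinAll, winAllSet, MultiHardAt, sepLift,
Triangular) are inlined in the items and
certified equal to the node file's (sk/ProductDialSketch.lean: Iff.rfl /
Finset.filter_congr_decidable, rc 0).

Novelty: Searches (2026-08-30, writer + lens): lit search "XOR lemma GF(2) polynomials Gowers norm" (6 local
docs; [corpus:doi-10-4086-toc-2008-v004a007 p.6 Cor. 1.6, p.9–10 Thm 1.2] Viola–Wigderson held and
read); lit galaxy search "Norms, XOR Lemmas|XOR lemma for polynomials|direct product theorem" --star
all (16 rows: [galaxy:pdf:-1327026717923147780] Grinberg–Shaltiel–Viola ECCC TR18-061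
hardness-amplification lower bounds, [galaxy:pdf:4256129860] Jain–Kundu DP for one-way quantum
communication, [galaxy:pdf:2704559931435564340] Chung–Liu parallel repetition; none on
𝔽_p-polynomial strategies for search relations); lens queries (NODE line 72): galaxy "parallel
repetition|direct product|XOR lemma|shallow circuits" and corpus hybrid "direct product low-degree
polynomials relation" (no hit joining direct products to the BGK/HLF ring relation beyond WKST19
§5's parallel repetition for NC⁰ circuits [arXiv:1906.08890]); rg over lean/Summits/QuantumAdvantage
for "n \^ K|JointStrategy|winAll|direct product" (no item quantifies over many rings;
RingHard8/RingHard/RingHardOdd are all single-ring); ledger negatives --problem QuantumAdvantage (no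
many-rings or loss-dial statement among B01–B..).
Nearest prior art found: in tree — DWalkThree:22907 (T, single ring, constant θ, odd class),
DegreeDial:24213/24214 (affine slice + degree lift of T), OddPrimeWalk's RingHard8 bridge
`hlfNotFAC0Mod_of_ringHard8` (single 8t-cycle); in print — WKST19 arXiv:1906.08890 §5 (parallel
repetition of the BGK ga  [refs: 10.4086/toc.2008.v004a007, 10.1137/080734030, 1906.08890, doi-10-4086-toc-2008-v004a007, doi:10.4086/toc.2008.v004a007, doi:10.1137/080734030]

Barriers (technique_class: direct-product, two-moduli-correlation, polynomial-method): - technique_class: direct-product, two-moduli-correlation, polynomial-method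
- Literature.Barriers.QuantumAdvantage.TwoModuliDepthTwo: PolyLoss3's degree-1 rung sits INSIDE its
proved class (bottom fan-in 1: `twoModuliDepthTwo_holds`, Green 2004) and is PROVED there
(polyLossOne3); PolyLoss3 at degree ≥ 2 and DPLift3 must evade it exactly as DegreeDial's
StepOneTwo3 (evasion (1): a two-moduli bound at bottom fan-in ≥ 2) — but PolyLoss3 asks only an
inverse-polynomial loss, not exact computation or constant correlation, which the barrier's
scope_caveats (EXACT computation of AND only) do not cover
[Literature/Barriers/QuantumAdvantage/TwoModuliDepthTwo.lean:627].
- Literature.Barriers.QuantumAdvantage.NonclassicalDegreeLogBarrier: does NOT bite PolyLoss3 or T* —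
it caps correlation bounds below 1/√n at degree ≥ log₂ n (`bhowmickLovett_thm31`); PolyLoss3 needs
loss 1/n^k (weaker than any correlation bound) and T* a constant θ obtained by amplification over
rings, not by a single-polynomial correlation estimate; DPLift3 is where a degree-norm argument
WOULD hit the wall (Viola–Wigderson decay 4^(−d)) — the bet is a white-box induction over rings
(triangular case proved) instead of a norm.
- Literature.Barriers.QuantumAdvantage.NaturalProofs: inside-and-unobstructed — bounds against
polylog-degree 𝔽₃-polynomial tuples, a class without PRFs (Razborov–Rudich needs pseudorandom
functions in the class).
- Literature.Barriers.QuantumAdvantage.Relativization: does not quantify over a f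

sub-problem: QuantumAdvantage · status: draft · opened planner-decomp-qadv-writer-1-g2-0 2026-08-30T03:01:58Z · rev 2 · ledger route-QuantumAdvantage-ProductDial
GENERATED by the gate from the ledger (D-0016/17). Provers cite these decls: `theorem foo : Summit.QuantumAdvantage.QuantumAdvantage.Theses.ProductDial.<Decl> := …` in Summits/QuantumAdvantage/QuantumAdvantage/Theorems/<Name>.lean.
-/

namespace Summit.QuantumAdvantage.QuantumAdvantage.Theses.ProductDial

open scoped BigOperators Topology Manifold Classical MeasureTheory ProbabilityTheory Matrix InnerProductSpace ComplexConjugate ContinuousMap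
open Filter Set Function TopologicalSpace MeasureTheory

attribute [summit_statement] _root_.QuantumAdvantage
attribute [summit_statement] _root_.Summit.QuantumAdvantage.AdviceFreeQNC0.AdviceFreeQNC0Three

open Literature.QuantumAdvantage

/-- item stmt-QuantumAdvantage-26122 · target · rank 0 · open · by planner
why it might fail: only if T* is false, which (given PolyLoss3) refutes T = RingHardOdd 3 and with it DWalkThree:22907 and DegreeDial:24213 — a joint polylog-degree strategy winning all n^K rings with probability bounded below would be a new classical simulation phenomenon for HLF.
sources: arXiv:1704.00690, arXiv:1906.08890, doi:10.4086/toc.2008.v004a007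
[target] T* (the reformulated target, rank 0; assembly conclusion of layer 2): there are K and θ < 1
such that for every c, for all large n, every joint strategy for n^K rings of length n whose outputs
are 𝔽₃-polynomials of degree ≤ (log₂ n)^c in all n^K·n input bits wins all rings (each ring's output
satisfies RingHLF.Rel) on at most θ·2^(n^K·n) input tuples. T → T* proved (node file
`multiRingHard3_of_ringHardOdd`); T* → PolyLoss3 proved (`polyLoss3_of_multiRingHard3`). [deps:
PolyLoss3, DPLift3] [difficulty: open-problem] -/
@[route_item "route-QuantumAdvantage-ProductDial"]
def MultiRingHard3 : Prop :=
  ∃ K : ℕ, ∃ θ : ℝ, θ < 1 ∧ ∀ c : ℕ, ∃ n₀ : ℕ, ∀ n ≥ n₀, ∀ P : Fin (n ^ K) → Fin n → Literature.Computability.MetaComplexity.Smolensky.CubeFn (ZMod 3) (n ^ K * n), (∀ j i, P j i ∈ Literature.Computability.MetaComplexity.Smolensky.lowDeg (ZMod 3) (n ^ K * n) ((Nat.log 2 n) ^ c)) → ((Finset.univ.filter fun X : Fin (n ^ K) → Fin n → Bool => ∀ j, Literature.Computability.QuantumComplexity.RingHLF.Rel (X j) (fun i => decide (P j i (fun k =>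 X (finProdFinEquiv.symm k).1 (finProdFinEquiv.symm k).2) = 1))).card : ℝ) ≤ θ * (2 : ℝ) ^ (n ^ K * n)

/-- item stmt-QuantumAdvantage-26123 · crux · rank 2 · open · by planner
why it might fail: open above degree 1: a degree-(log n)^c tuple might interpolate the which-path walk on all but an n^(−ω(1)) fraction of inputs (census LAW F3 pins loss 1/2 only for shift-periodic local strategies); no loss bound for 𝔽₃ tuples vs the mod-2 path count is in print beyond affine.
sources: arXiv:1704.00690, arXiv:1906.08890, doi:10.1145/28395.28404, doi:10.1016/j.jcss.2004.01.003
[crux] inverse-polynomial single-ring loss at every polylog degree: some k such that for every c,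
for all large n, every single-ring 𝔽₃-strategy (z_i = [P_i(x) = 1], deg P_i ≤ (log₂ n)^c) satisfies
the n-cycle relation RingHLF.Rel on at most (1 − n^(−k))·2^n of ALL 2^n inputs (plain count).
Strictly weaker than T (T ⇒ PolyLoss3, `polyLoss3_of_ringHardOdd`) and than AffineCore3's
constant-loss demand; degree-1 slice PROVED (`polyLossOne3`, from the tree's
AffBells37.affBellsPolyLoss3). [difficulty: L] -/
@[route_item "route-QuantumAdvantage-ProductDial", crux]
def PolyLoss3 : Prop :=
  ∃ k : ℕ, ∀ c : ℕ, ∃ n₀ : ℕ, ∀ n ≥ n₀, ∀ P : Fin n → Literature.Computability.MetaComplexity.Smolensky.CubeFn (ZMod 3) n, (∀ i, P i ∈ Literature.Computability.MetaComplexity.Smolensky.lowDeg (ZMod 3) n ((Nat.log 2 n) ^ c)) → ((Finset.univ.filter fun x : Fin n → Bool => Literature.Computability.QuantumComplexity.RingHLF.Rel x (fun i => decide (P i x = 1))).card : ℝ) ≤ (1 - 1 / (n : ℝ) ^ k) * (2 : ℝ) ^ n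

/-- item stmt-QuantumAdvantage-26124 · crux · rank 3 · open · by planner
why it might fail: no direct-product theorem for polylog-degree 𝔽_p polynomials exists: Viola–Wigderson's decays like exp(−Ω(εm/(d·4^d))), vacuous at d ≥ log m; rings read jointly can correlate wins (only causal orders proved); GSV18: black-box amplification proofs need majority, absent at low degree.
sources: doi:10.4086/toc.2008.v004a007, doi:10.1137/080734030, arXiv:1906.08890, eccc:TR18-061
[crux] DECLARED-RESIDUAL (NO-SHRINK piece, critic row 9): the direct-product lift PolyLoss3 →
MultiRingHard3 — an inverse-polynomial loss per ring at every polylog degree amplifies, over n^K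
disjoint rings read JOINTLY, to a constant all-rings bound. Proved special cases in the node file:
separable strategies (`dpSeparable3`) and triangular/causal reading orders (`dpTriangular3`,
induction over rings via `card_winAllSet_triangular_le`); the symmetric cross-reading case is the
open content; constant-degree sub-rung DPLiftConst3 filed as aside. [deps: PolyLoss3] [difficulty:
open-problem] -/
@[route_item "route-QuantumAdvantage-ProductDial", crux (bottleneck := idea) (source := "ledger wanted_by.residual on stmt-QuantumAdvantage-26124, 2026-09-01")]
def DPLift3 : Prop :=
  PolyLoss3 → MultiRingHard3

/-- item stmt-QuantumAdvantage-26125 · support · rank 9 · closed · proved by Summit.QuantumAdvantage.QuantumAdvantage.Theorems.pencilDial_multiRingBridge3 (prover) · by planner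
why it might fail: routine adaptation, two checks: the grid side N ≈ n^((K+1)/2)·O(1) must carry n^K disjoint cycles with disjoint encodings, and the probabilistic-polynomial error (1/poly(N)) must be charged once to the joint tuple, not per ring.
sources: arXiv:1704.00690, arXiv:1906.08890, doi:10.1145/28395.28404
[support] LOAD-BEARING support (binder of `closes`; critic: staff/land FIRST): T* feeds the
registered leaf hypothesis — MultiRingHard3 → HLFNotFAC0Mod 3: restrict N×N 2D-HLF circuits over
accBasis 3 to instances carrying n^K disjoint square cycles of length n, turn the FAC⁰[3] circuit
tuple into ONE joint polylog-degree 𝔽₃-strategy for all rings at once by the relational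
Razborov–Smolensky lemma (tree `Smolensky.exists_uniformProb_le`, error counted once for the whole
tuple), transfer HLF solutions to ring wins ring by ring (tree `GridCycle.rel_of_mem_hlfSolutions`),
exactly as the single-ring bridge `Theorems.hlfNotFAC0Mod_of_ringHard8` (RingFrameBridge.lean:119)
with the packing of n^K cycles replacing one 8t-cycle. [difficulty: M] STATUS 2026-08-30 (record
correction): PROVED in a LAND-READY file — BridgeDial (lens-5 g6) Theorems/MultiRingBridge.lean
sha256 d782ca8a… (832 l, farm rc0 · 0 sorry): `Theorems.productDial_multiRingBridge3 :
ProductDial.MultiRingBridge3` (this shared decl — closes the item in all six routes) and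
`adviceFreeQNC0Three_of_multiRingHard3 : MultiRingHard3 → AdviceFreeQNC0Three`; attached as evidence
on this item; LAND FIRST `ledger propose --kind proof -- -/
@[route_item "route-QuantumAdvantage-ProductDial", crux]
def MultiRingBridge3 : Prop :=
  MultiRingHard3 → Summit.QuantumAdvantage.AdviceFreeQNC0.HLFNotFAC0Mod 3

-- `MultiRingBridge3` holds: proved by `Summit.QuantumAdvantage.QuantumAdvantage.Theorems.pencilDial_multiRingBridge3` (its module imports this route file, so no `_holds` link can be stated here).

/-- item stmt-QuantumAdvantage-26126 · aside · rank 9 · open · by planner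
sources: arXiv:1704.00690, doi:10.1016/j.jcss.2004.01.003
[support] ASIDE (file as kind aside; PROVED in the node file, theorem `polyLossOne3`, from the
tree's `AffBells37.affBellsPolyLoss3` + the even-class count): the degree-1 slice of PolyLoss3 —
affine single-ring strategies lose an inverse-polynomial fraction of all inputs. BC5 witness rung of
PolyLoss3 (outside S's known regime: T's affine slice AffineCore3 = BondTwist3.RingAffineBellsLt3 is
OPEN). [difficulty: S] -/
@[route_item "route-QuantumAdvantage-ProductDial"]
def PolyLossOne3 : Prop :=
  ∃ k : ℕ, ∃ n₀ : ℕ, ∀ n ≥ n₀, ∀ P : Fin n → Literature.Computability.MetaComplexity.Smolensky.CubeFn (ZMod 3) n, (∀ i, P i ∈ Literature.Computability.MetaComplexity.Smolensky.lowDeg (ZMod 3) n 1) → ((Finset.univ.filter fun x : Fin n → Bool => Literature.Computability.QuantumComplexity.RingHLF.Rel x (fun i => decide (P i x = 1))).card : ℝ) ≤ (1 - 1 / (n : ℝ) ^ k) * (2 : ℝ) ^ n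

/-- item stmt-QuantumAdvantage-26127 · aside · rank 9 · open · by planner
sources: doi:10.1016/j.jcss.2004.01.003, doi:10.4086/toc.2008.v004a007
[support] ASIDE (kind aside; first OPEN rung of the loss dial, ATTACKABLE): the degree-2 slice of
PolyLoss3 — quadratic single-ring 𝔽₃-strategies lose an inverse-polynomial fraction of all inputs
(census v2 T2: the degree-2 margin over affine is transient at N ≤ 12). [difficulty: M] -/
@[route_item "route-QuantumAdvantage-ProductDial"]
def PolyLossTwo3 : Prop :=
  ∃ k : ℕ, ∃ n₀ : ℕ, ∀ n ≥ n₀, ∀ P : Fin n → Literature.Computability.MetaComplexity.Smolensky.CubeFn (ZMod 3) n, (∀ i, P i ∈ Literature.Computability.MetaComplexity.Smolensky.lowDeg (ZMod 3) n 2) → ((Finset.univ.filter fun x : Fin n → Bool => Literature.Computability.QuantumComplexity.RingHLF.Rel x (fun i => decide (P i x = 1))).card : ℝ) ≤ (1 - 1 / (n : ℝ) ^ k) * (2 : ℝ) ^ n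

/-- item stmt-QuantumAdvantage-26128 · aside · rank 9 · open · by planner
sources: doi:10.4086/toc.2019.v015a001, doi:10.1145/28395.28404
[support] ASIDE (kind aside; the rung just past the degree-log line): the degree-log₂ n slice of
PolyLoss3. [difficulty: L] -/
@[route_item "route-QuantumAdvantage-ProductDial"]
def PolyLossLog3 : Prop :=
  ∃ k : ℕ, ∃ n₀ : ℕ, ∀ n ≥ n₀, ∀ P : Fin n → Literature.Computability.MetaComplexity.Smolensky.CubeFn (ZMod 3) n, (∀ i, P i ∈ Literature.Computability.MetaComplexity.Smolensky.lowDeg (ZMod 3) n (Nat.log 2 n)) → ((Finset.univ.filter fun x : Fin n → Bool => Literature.Computability.QuantumComplexity.RingHLF.Rel x (fun i => decide (P i x = 1))).card : ℝ) ≤ (1 - 1 / (n : ℝ) ^ k) * (2 : ℝ) ^ n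

/-- item stmt-QuantumAdvantage-26129 · aside · rank 9 · open · by planner
sources: doi:10.4086/toc.2008.v004a007
[support] ASIDE (kind aside; PROVED from PolyLoss3 in the node file, `dpSeparable3`): T* for
SEPARABLE joint strategies (ring j reads only ring j) — the product case of the direct product, by
independence and (1 − n^(−k))^(n^(k+1)) ≤ e^(−1)-type decay. [difficulty: S] -/
@[route_item "route-QuantumAdvantage-ProductDial"]
def MultiRingHardSeparable3 : Prop :=
  ∃ K : ℕ, ∃ θ : ℝ, θ < 1 ∧ ∀ c : ℕ, ∃ n₀ : ℕ, ∀ n ≥ n₀, ∀ Q : Fin (n ^ K) → Fin n → Literature.Computability.MetaComplexity.Smolensky.CubeFn (ZMod 3) n, (∀ j i, Q j i ∈ Literature.Computability.MetaComplexity.Smolensky.lowDeg (ZMod 3) n ((Nat.log 2 n) ^ c)) → ((Finset.univ.filter fun X : Fin (n ^ K) → Fin n → Bool => ∀ j, Literature.Computability.QuantumComplexity.RingHLF.Rel (X j) (fun i => decide (Q j i (fun s => X (finProdFinEquiv.symm (finProdFinEquiv (j, s))).1 (finProdFinEquiv.symm (finProdFinEquiv (j, s))).2) = 1))).card : ℝ)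 ≤ θ * (2 : ℝ) ^ (n ^ K * n)

/-- item stmt-QuantumAdvantage-26130 · aside · rank 9 · open · by planner
sources: doi:10.4086/toc.2008.v004a007, doi:10.1137/080734030
[support] ASIDE (kind aside; PROVED from PolyLoss3 in the node file, `dpTriangular3` via
`card_winAllSet_triangular_le`): T* for TRIANGULAR joint strategies (ring j's outputs read only
rings j' ≥ j) — the causal case of the direct product, an induction over rings conditioning on the
tail. [difficulty: S] -/
@[route_item "route-QuantumAdvantage-ProductDial"]
def MultiRingHardTriangular3 : Prop :=
  ∃ K : ℕ, ∃ θ : ℝ, θ < 1 ∧ ∀ c : ℕ, ∃ n₀ : ℕ, ∀ n ≥ n₀, ∀ P : Fin (n ^ K) → Fin n → Literature.Computability.MetaComplexity.Smolensky.CubeFn (ZMod 3) (n ^ K * n), (∀ j i (X X' : Fin (n ^ K) → Fin n → Bool), (∀ j', j ≤ j' → X j' = X' j') → P j i (fun k => X (finProdFinEquiv.symm k).1 (finProdFinEquiv.symm k).2) = P j i (fun k => X' (finProdFinEquiv.symm k).1 (finProdFinEquiv.symm k).2)) → (∀ j i, P j i ∈ Literature.Computability.MetaComplexity.Smolensky.lowDeg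 (ZMod 3) (n ^ K * n) ((Nat.log 2 n) ^ c)) → ((Finset.univ.filter fun X : Fin (n ^ K) → Fin n → Bool => ∀ j, Literature.Computability.QuantumComplexity.RingHLF.Rel (X j) (fun i => decide (P j i (fun k => X (finProdFinEquiv.symm k).1 (finProdFinEquiv.symm k).2) = 1))).card : ℝ) ≤ θ * (2 : ℝ) ^ (n ^ K * n)

/-- item stmt-QuantumAdvantage-26131 · aside · rank 9 · open · by planner
sources: doi:10.1016/j.jcss.2004.01.003, arXiv:1906.08890
[support] ASIDE with a RANK NOTE (kind aside at birth for BC6; critic row 9 recommends it as the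
natural FIRST STAFFED statement of this route — tenure may promote it to a ranked statement): T* for
JOINT AFFINE strategies (every output of degree ≤ 1 in all n^K·n bits) — the first open rung of T*
proper; its separable sub-case is PROVED unconditionally (`multiRingHardSepAffine3`), while T's
affine slice AffineCore3 (DegreeDial:24214) is open; it is the d = 1 case of DPLiftConst3
(`multiRingHardAffine3_of_dpLiftConst3`). [difficulty: M] -/
@[route_item "route-QuantumAdvantage-ProductDial"]
def MultiRingHardAffine3 : Prop :=
  ∃ K : ℕ, ∃ θ : ℝ, θ < 1 ∧ ∃ n₀ : ℕ, ∀ n ≥ n₀, ∀ P : Fin (n ^ K) → Fin n → Literature.Computability.MetaComplexity.Smolensky.CubeFn (ZMod 3) (n ^ K * n), (∀ j i, P j i ∈ Literature.Computability.MetaComplexity.Smolensky.lowDeg (ZMod 3) (n ^ K * n) 1) → ((Finset.univ.filter fun X : Fin (n ^ K) → Fin n → Bool => ∀ j, Literature.Computability.QuantumComplexity.RingHLF.Rel (X j) (fun i => decide (P j i (fun k => X (finProdFinEquiv.symm k).1 (finProdFinEquiv.symm k).2) = 1))).card : ℝ) ≤ θ * (2 : ℝ) ^ (n ^ K * n)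

/-- item stmt-QuantumAdvantage-26132 · aside · rank 9 · open · by planner
sources: doi:10.4086/toc.2008.v004a007
[support] ASIDE (kind aside; the ATTACKABLE constant-degree sub-rung of DPLift3 suggested by the
critic, row 9 (ii)): for every fixed total degree d, an inverse-polynomial single-ring loss at
degree d implies T* at degree d (some K, θ < 1) — the 𝔽₃/search-relation analogue of
Viola–Wigderson's direct-product lemma for constant-degree GF(2) polynomials (Cor. 1.6), whose decay
exp(−Ω(εm/(d·4^d))) is non-trivial exactly in this regime. [difficulty: L] -/
@[route_item "route-QuantumAdvantage-ProductDial"]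
def DPLiftConst3 : Prop :=
  ∀ d : ℕ, (∃ k : ℕ, ∃ n₀ : ℕ, ∀ n ≥ n₀, ∀ P : Fin n → Literature.Computability.MetaComplexity.Smolensky.CubeFn (ZMod 3) n, (∀ i, P i ∈ Literature.Computability.MetaComplexity.Smolensky.lowDeg (ZMod 3) n d) → ((Finset.univ.filter fun x : Fin n → Bool => Literature.Computability.QuantumComplexity.RingHLF.Rel x (fun i => decide (P i x = 1))).card : ℝ) ≤ (1 - 1 / (n : ℝ) ^ k) * (2 : ℝ) ^ n) → ∃ K : ℕ, ∃ θ : ℝ, θ < 1 ∧ ∃ n₀ : ℕ, ∀ n ≥ n₀, ∀ P : Fin (n ^ K) → Fin n → Literature.Computability.MetaComplexity.Smolensky.CubeFn (ZMod 3) (n ^ K * n), (∀ j i, P j i ∈ Literature.Computability.MetaComplexity.Smolensky.lowDeg (ZMod 3) (n ^ K * n) d) → ((Finset.univ.filter fun X : Fin (n ^ K) → Fin n → Bool => ∀ j, Literature.Computability.QuantumComplexity.RingHLF.Rel (X j) (fun i => decide (P j i (fun k => X (finProdFinEquiv.symm k).1 (finProdFinEquiv.symm k).2) = 1))).card : ℝ)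 ≤ θ * (2 : ℝ) ^ (n ^ K * n)

/-- item stmt-QuantumAdvantage-26531 · aside · rank 9 · open · by planner
sources: arXiv:1704.00690, doi:10.1016/j.jcss.2004.01.003
[target] THE JUNCTION X (shared with ProductDial's layer 2; critic grammar 02:48:23Z, ∃C ∀c — the
STRONG quantifier order ProductDial's direct product needs): ONE exponent C such that at every
polylog output degree (log₂ n)^c, for all large n, every 𝔽₃-polynomial strategy wins at most (1 −
n^(−C))·2^(n−1) of the ODD patterns of the n-cycle ring relation. NECESSARY for T = `RingHardOdd 3`
(C := 1, lens kernels `polyLossOdd3u_of_ringHardOdd` / `polyLossOddU3_of_ringHardOdd`); implies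
ProductDial's PolyLoss3 (OddToAll3, k := C+1) and lens-1's PolyLossOdd3 trivially; its degree-1
slice is the tree theorem `AffBells37.affBellsPolyLoss3` ON THE NOSE (lens-5 `oddLossAt_one`);
`ExactnessDial.PolyLossOdd3u ↔ ProductDial.PolyLossOddU3 := Iff.rfl` (critic merged farm check
02:59:21Z). Here X ⟺ NoPerfectOdd3 ∧ MassStep3u (`node_iff_B`). [deps: NoPerfectOdd3, MassStep3u]
[difficulty: open-problem] LEADER RECORD (2026-08-30; lens-2 g12 «LeaderDial» node 47ef054c, 1154 l,
farm rc0 · 0 sorry · 0 warn · axioms std · bc P1–P8 must-fail FAIL; critic row 57 VERIFIED HIGH,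
LAW-node; NO items — caps; residuals recorded): ONE-POLYNOMIAL NORMAL FORM — `symLaw3 :
PolyLossOddU3 ↔ CovPolyLossOddU3` PROVED bo -/
@[route_item "route-QuantumAdvantage-ProductDial"]
def PolyLossOddU3 : Prop :=
  ∃ C : ℕ, ∀ c : ℕ, ∃ n₀ : ℕ, ∀ n ≥ n₀, ∀ P : Fin n → Literature.Computability.MetaComplexity.Smolensky.CubeFn (ZMod 3) n, (∀ i, P i ∈ Literature.Computability.MetaComplexity.Smolensky.lowDeg (ZMod 3) n ((Nat.log 2 n) ^ c)) → ((Finset.univ.filter fun x : Fin n → Bool => Summit.QuantumAdvantage.AdviceFreeQNC0.OddZeros x ∧ Literature.Computability.QuantumComplexity.RingHLF.Rel x (fun i => decide (P i x = 1))).card : ℝ) ≤ (1 - 1 / (n : ℝ) ^ C) * (2 : ℝ) ^ (n - 1)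

/-- item stmt-QuantumAdvantage-26534 · aside · rank 9 · closed · proved by Summit.QuantumAdvantage.QuantumAdvantage.Theorems.ExactnessDialOddToAll.exactnessDial_oddToAll3 (prover) · by planner
sources: arXiv:1704.00690
[support] the DICTIONARY odd-class ⟹ all-pattern polynomial loss (k := C+1; the even class has ≤
2^(n−1) patterns, `Summit.QuantumAdvantage.AdviceFreeQNC0.card_even_class_le`, n ≥ 2). PROVED
sorry-free in both lens files (`ExactnessDial.PD.polyLoss3_of_polyLossOdd3u`,
`ProductDial.polyLoss3_of_polyLossOddU3`); consumed by closes; shared with ProductDial's layer 2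
(its closes₃ needs the same step). [difficulty: provable-now] PROVED 2026-08-30 in lens-2 g12
«LeaderDial» node 47ef054c (`oddToAll3`: odd ⟹ all dictionary, k := C+1; critic row 57
kernel-confirmed proof-of-item `exactnessDial_oddToAll3 ⊢ Theses.ExactnessDial.OddToAll3`); closes
on landing of HOME/decomp-qadv-lens-2/g12/tree/ExactnessDialOddToAll.lean (eba11686, stand-alone,
farm rc0 audit ok) --workitem stmt-QuantumAdvantage-26534 (census/prover lane). -/
@[route_item "route-QuantumAdvantage-ProductDial"]
def OddToAll3 : Prop :=
  PolyLossOddU3 → PolyLoss3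

-- `OddToAll3` holds: proved by `Summit.QuantumAdvantage.QuantumAdvantage.Theorems.ExactnessDialOddToAll.exactnessDial_oddToAll3` (its module imports this route file, so no `_holds` link can be stated here).

/-- item stmt-QuantumAdvantage-26769 · aside · rank 9 · open · by planner
sources: doi:10.1145/28395.28404, arXiv:1704.00690
[support] aside (kind aside, PROVED in the lens file `detSep_three_of_polyLoss3Shape`, transported
`polyLossDetSep3_holds`): the CROSS-NODE PAY-OUT at p = 3 — ProductDial's crux PolyLoss3
(stmt-QuantumAdvantage-26123, hypothesis written verbatim) ALONE gives «zero-error advice-free QNC⁰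
⊄ deterministic FAC⁰[3]», with no direct product (DPLift3) and no constant-loss step; recorded here
once for all p as the law «1/poly-loss grade at all polylog degrees + Razborov–Smolensky(ε = n^(−k))
⇒ deterministic leaf» and attached to ProductDial as the same item. [difficulty: provable-now] -/
@[route_item "route-QuantumAdvantage-ProductDial"]
def PolyLossDetSep3 : Prop :=
  (∃ k : ℕ, ∀ c : ℕ, ∃ n₀ : ℕ, ∀ n ≥ n₀, ∀ P : Fin n → Literature.Computability.MetaComplexity.Smolensky.CubeFn (ZMod 3) n, (∀ i, P i ∈ Literature.Computability.MetaComplexity.Smolensky.lowDeg (ZMod 3) n ((Nat.log 2 n) ^ c)) → ((Finset.univ.filter fun x : Fin n → Bool => Literature.Computability.QuantumComplexity.RingHLF.Rel x (fun i => decide (P i x = 1))).card : ℝ) ≤ (1 - 1 / (n : ℝ) ^ k) * (2 : ℝ) ^ n) → ∃ R : Literature.Computability.QuantumComplexity.RelFamily, (∃ b : Polynomial ℕ, ∀ n, R.inLen n ≤ b.eval n) ∧ Literature.Computability.QuantumComplexity.QNC0Solves R 0 ∧ (∀ d : ℕ, ∀ s : Polynomial ℕ, ∃ N₀ : ℕ,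 ∀ n ≥ N₀, ∀ Cs : Fin (R.outLen n) → Literature.Computability.Complexity.Circuit (Fin (R.inLen n + 0)), (∀ i, (Cs i).IsOver (Literature.Computability.Complexity.accBasis 3)) → (∀ i, (Cs i).acDepth ≤ d) → (∀ i, (Cs i).size ≤ s.eval n) → ∃ x ∈ R.dom n, ∀ ρ : List Bool, ¬ R.valid n x (fun i => (Cs i).eval (Fin.append x fun j => ρ.getD j false)))

/-- item stmt-QuantumAdvantage-26133 · assembly · rank 1 · open · by planner
sources: arXiv:1704.00690
[assembly] PolyLoss3 → DPLift3 → MultiRingBridge3 → AdviceFreeQNC0Three -/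
@[route_item "route-QuantumAdvantage-ProductDial"]
def Assembly : Prop :=
  PolyLoss3 → DPLift3 → MultiRingBridge3 → Summit.QuantumAdvantage.AdviceFreeQNC0.AdviceFreeQNC0Three

/-! D-0027 §2.1 — DECIDING THEOREM (planner-authored via `route open/edit --closes-file`; by planner-decomp-qadv-writer-1-g2-0 2026-08-30T03:01:58Z):
its hypotheses are this route's items and its conclusion the registered leaf `Summit.QuantumAdvantage.AdviceFreeQNC0.AdviceFreeQNC0Three` (rung F-Q1-p3, D-0061) (glue_lint), and it elaborates with this file. -/

/-- Deciding theorem of route ProductDial (decomp-qadv lens 5 gen 2): the single-ring inverse-polynomial loss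
`PolyLoss3`, lifted by the direct product `DPLift3` to the many-rings bound T* = `MultiRingHard3`, feeds the
registered leaf hypothesis `HLFNotFAC0Mod 3` through `MultiRingBridge3`; the landed bridge
`Theorems.adviceFreeQNC0Sep_of_hlfNotFAC0Mod` and `adviceFreeQNC0Three_iff` conclude the rung leaf F-Q1-p3. -/
@[closes "route-QuantumAdvantage-ProductDial"] theorem closes (hP : PolyLoss3) (hD : DPLift3) (hB : MultiRingBridge3) :
    Summit.QuantumAdvantage.AdviceFreeQNC0.AdviceFreeQNC0Three :=
  Summit.QuantumAdvantage.AdviceFreeQNC0.adviceFreeQNC0Three_iff.mpr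
    (Summit.QuantumAdvantage.QuantumAdvantage.Theorems.adviceFreeQNC0Sep_of_hlfNotFAC0Mod 3 (hB (hD hP)))

end Summit.QuantumAdvantage.QuantumAdvantage.Theses.ProductDial
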